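import Summits.CriticalPhenomena.PercolationContinuityZ3.Theorems.PercNearOneGluingNoHeavyLowerTailCILPeeling
import HarnessLib

/-!
# `NoHeavyLowerTail` (stmt-CriticalPhenomena-4575) — the WITNESS-UPGRADE rule for the peeling certificate scheme

Lemma factory #5 (`prim-lf-5`, gen 14; memo `run/shared/lean/prim/prim-lf-5/STAR-RECURSION.md` §5).
`--supports stmt-CriticalPhenomena-4575`.  No definitions, no named facts, no sorries.

The peeling scheme of `…CILStarTransfer.lean` / `…CILPeeling.lean` (prover `prim-gen-induct`) certifies the cumulative
isolation lemma CIL_j at an observer by recursively establishing the SET-CHAMPION-STABILITY inequality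

  `CS_w(S, c) :  μ(c ↮ S, 1 ≤ |π(S)| ≤ j) ≤ μ(c ↮ S, |π(c)| ≤ j)`     (`π(S) = ⋃_{x∈S} π(x)`, `π(x) = {z ∈ A : x ↔ z}`)

with a FIXED witness `c` along the recursion (discharge by `observerSet_le_of_lonelier`, peel by `setCS_of_peeling`).  Its
exact-enumeration residual (≈ 1 %, prim-lf-7 `EXPLORATION-CLASS.md`: "lonely deep hit" leaves) is a witness LOCK-IN: the
explored branch needs a different relay.  This file adds the rule that legitimises switching:

* `CutObserver.real_setSmallPos_eq` — for a relay `x`, `μ(1 ≤ |π(S)| ≤ j) = μ(x ↮ S, 1 ≤ |π(S)| ≤ j) + μ(x ↔ S, |π(S)| ≤ j)`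
  (if the relay `x` is joined to `S` it lies in `π(S)`);
* `setCS_of_upgrade` — **witness upgrade**: `CS_w(S, c)` is equivalent to `μ(1 ≤ |π(S)| ≤ j) ≤ g(c)` with
  `g(x) := μ(x ↔ S, |π(S)| ≤ j) + μ(x ↮ S, |π(x)| ≤ j)` — the probability that `x`'s pocket is small in the graph with `S` GLUED into
  `x`'s reach ("glued lightness") — so `CS_w(S, c')` and `g(c') ≤ g(c)` give `CS_w(S, c)`: at every node of the peeling tree the
  witness may be replaced by any relay that is at least as HEAVY in the glued graph, e.g. a relay adjacent to the explored set.
  With this rule the scheme ("peel + upgrade") certifies every instance in the seat's census (≈ 2 650 random deep / tie / near-glue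
  (instance, level) cases n ≤ 8, the binary-Steiner-tree family, and the documented structural failure of the fixed-witness scheme),
  see the memo; the rule itself is elementary bookkeeping.
-/

noncomputable section

namespace Summit.CriticalPhenomena.PercolationContinuityZ3.Theorems

open MeasureTheory Set Literature.Probability.LatticeModels Literature.Probability.Percolation
open scoped Classical BigOperators

variable {n : ℕ}

namespace CutObserver

/-- **Splitting the small-pocket event of a set along a relay.**  For `x ∈ A`:
`μ(1 ≤ |π(S)| ≤ j) = μ(x ↮ S, 1 ≤ |π(S)| ≤ j) + μ(x ↔ S, |π(S)| ≤ j)` — on `{x ↔ S}` the relay `x` itself lies in `π(S)`.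
[folklore] -/
theorem real_setSmallPos_eq (w : Sym2 (Fin n) → unitInterval) (A S : Finset (Fin n)) (j : ℕ) {x : Fin n}
    (hx : x ∈ A) :
    (prodBernoulli w).real {ω : BondConfig (Fin n) |
        1 ≤ (A.filter fun z => ∃ y ∈ S, ω ∈ openConn y z).card ∧
          (A.filter fun z => ∃ y ∈ S, ω ∈ openConn y z).card ≤ j} =
      (prodBernoulli w).real {ω : BondConfig (Fin n) | (∀ y ∈ S, ω ∉ openConn x y) ∧
          1 ≤ (A.filter fun z => ∃ y ∈ S, ω ∈ openConn y z).card ∧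
          (A.filter fun z => ∃ y ∈ S, ω ∈ openConn y z).card ≤ j} +
        (prodBernoulli w).real {ω : BondConfig (Fin n) | (∃ y ∈ S, ω ∈ openConn x y) ∧
          (A.filter fun z => ∃ y ∈ S, ω ∈ openConn y z).card ≤ j} := by
  set μ := prodBernoulli w with hμ
  set T : Set (BondConfig (Fin n)) := {ω | 1 ≤ (A.filter fun z => ∃ y ∈ S, ω ∈ openConn y z).card ∧
    (A.filter fun z => ∃ y ∈ S, ω ∈ openConn y z).card ≤ j} with hT
  set L : Set (BondConfig (Fin n)) := {ω | (∀ y ∈ S, ω ∉ openConn x y) ∧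
    1 ≤ (A.filter fun z => ∃ y ∈ S, ω ∈ openConn y z).card ∧
    (A.filter fun z => ∃ y ∈ S, ω ∈ openConn y z).card ≤ j} with hL
  set M : Set (BondConfig (Fin n)) := {ω | (∃ y ∈ S, ω ∈ openConn x y) ∧
    (A.filter fun z => ∃ y ∈ S, ω ∈ openConn y z).card ≤ j} with hM
  have hdisj : Disjoint L M := by
    refine Set.disjoint_left.2 fun ω hωL hωM => ?_
    obtain ⟨y, hyS, hxy⟩ := hωM.1
    exact hωL.1 y hyS hxy
  have hTeq : T = L ∪ M := by
    ext ω
    simp only [hT, hL, hM, mem_setOf_eq, mem_union]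
    constructor
    · rintro ⟨h1, h2⟩
      by_cases hsep : ∀ y ∈ S, ω ∉ openConn x y
      · exact Or.inl ⟨hsep, h1, h2⟩
      · push Not at hsep
        obtain ⟨y, hyS, hxy⟩ := hsep
        exact Or.inr ⟨⟨y, hyS, hxy⟩, h2⟩
    · rintro (⟨-, h1, h2⟩ | ⟨⟨y, hyS, hxy⟩, h2⟩)
      · exact ⟨h1, h2⟩
      · refine ⟨?_, h2⟩
        rw [Nat.succ_le_iff, Finset.card_pos]
        refine ⟨x, Finset.mem_filter.2 ⟨hx, y, hyS, ?_⟩⟩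
        have hr : (openGraph ω).Reachable x y := hxy
        exact hr.symm
  rw [hTeq]
  exact measureReal_union hdisj MeasurableSet.of_discrete

end CutObserver

open CutObserver in
/-- **Witness upgrade for set-champion stability.**  Let `c, c' ∈ A` and write, for a relay `x`,
`g(x) = μ(x ↔ S, |π(S)| ≤ j) + μ(x ↮ S, |π(x)| ≤ j)` (the lightness of `x` with the set `S` glued into its reach).  If
`CS_w(S, c')` holds and `g(c') ≤ g(c)` (`c` is at least as light as `c'` in the glued sense), then `CS_w(S, c)` holds.
Indeed `CS_w(S, x)` is equivalent to `μ(1 ≤ |π(S)| ≤ j) ≤ g(x)` by `CutObserver.real_setSmallPos_eq`. [this work] -/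
theorem setCS_of_upgrade (w : Sym2 (Fin n) → unitInterval) (A S : Finset (Fin n)) (j : ℕ) {c c' : Fin n}
    (hc : c ∈ A) (hc' : c' ∈ A)
    (hCS' : (prodBernoulli w).real {ω : BondConfig (Fin n) | (∀ y ∈ S, ω ∉ openConn c' y) ∧
        1 ≤ (A.filter fun z => ∃ y ∈ S, ω ∈ openConn y z).card ∧
        (A.filter fun z => ∃ y ∈ S, ω ∈ openConn y z).card ≤ j} ≤
      (prodBernoulli w).real {ω : BondConfig (Fin n) | (∀ y ∈ S, ω ∉ openConn c' y) ∧
        (A.filter fun z => ω ∈ openConn c' z).card ≤ j})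
    (hg : (prodBernoulli w).real {ω : BondConfig (Fin n) | (∃ y ∈ S, ω ∈ openConn c' y) ∧
          (A.filter fun z => ∃ y ∈ S, ω ∈ openConn y z).card ≤ j} +
        (prodBernoulli w).real {ω : BondConfig (Fin n) | (∀ y ∈ S, ω ∉ openConn c' y) ∧
          (A.filter fun z => ω ∈ openConn c' z).card ≤ j} ≤
      (prodBernoulli w).real {ω : BondConfig (Fin n) | (∃ y ∈ S, ω ∈ openConn c y) ∧
          (A.filter fun z => ∃ y ∈ S, ω ∈ openConn y z).card ≤ j} +
        (prodBernoulli w).real {ω : BondConfig (Fin n) | (∀ y ∈ S, ω ∉ openConn c y) ∧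
          (A.filter fun z => ω ∈ openConn c z).card ≤ j}) :
    (prodBernoulli w).real {ω : BondConfig (Fin n) | (∀ y ∈ S, ω ∉ openConn c y) ∧
        1 ≤ (A.filter fun z => ∃ y ∈ S, ω ∈ openConn y z).card ∧
        (A.filter fun z => ∃ y ∈ S, ω ∈ openConn y z).card ≤ j} ≤
      (prodBernoulli w).real {ω : BondConfig (Fin n) | (∀ y ∈ S, ω ∉ openConn c y) ∧
        (A.filter fun z => ω ∈ openConn c z).card ≤ j} := by
  have e1 := real_setSmallPos_eq w A S j hc
  have e2 := real_setSmallPos_eq w A S j hc'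
  linarith

end Summit.CriticalPhenomena.PercolationContinuityZ3.Theorems

end
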